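import Summits.AtomisticToContinuum.HydrodynamicLimit.Theses.JParityClosure
import Summits.AtomisticToContinuum.HydrodynamicLimit.Theses.TwoClocks
import Summits.AtomisticToContinuum.HydrodynamicLimit.Theses.LimitCollisionMeasure
import Summits.AtomisticToContinuum.HydrodynamicLimit.Theorems.JParityClosureParityBandClosureStressIsotropyOfWindowCovarianceK
import Summits.AtomisticToContinuum.HydrodynamicLimit.Theorems.JParityClosureParityBandClosureStressIsotropyOfWindowCovarianceM
import Summits.AtomisticToContinuum.HydrodynamicLimit.Theorems.InformationPercolationEngineKineticClosureBridge
import HarnessLib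

/-!
# Window-to-cone step of `ParityBandClosure`: `WindowCovarianceIsotropy` + `DensityCap` + cubic tails + collision
# tightness ⇒ `WeakStressIsotropyInBand` (stub `stub_stressIsotropyOfWindowCovariance`)

The registered stub `stub_stressIsotropyOfWindowCovariance` of the line `transfer-weighted-parity-chain` (skeleton v4)
of the crux `JParityClosure.ParityBandClosure` (stmt-AtomisticToContinuum-17608):
`WindowCovarianceIsotropy → JParityClosure.DensityCap → TwoClocks.EnergyCurrentTails →
LimitCollisionMeasure.CollisionTightness → WeakStressIsotropyInBand`, the waypoint Props `WeakStressIsotropyInBand`,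
`WindowCovarianceIsotropy` copied VERBATIM from the skeleton.

PROOF.  `η₀ :=` the band of `WindowCovarianceIsotropy`; `σ₀ :=` the least of the four thresholds and `1/4`.  Given
WSI's data `(t < T, a, g, η, δ)`: `τ = (t + T)/2`; bounds `Gb` of `g` on `[0, ∞)` and `A` of `a` on `[0, τ] × 𝕋³`;
`δ' = δ/7`; the energy level `K_E` (`exists_energy_tail_le`); the pointwise cap `R = sup ρ + 1` from `DensityCap` at
horizon `τ`; the collision level `K_b` from `CollisionTightness`; the tolerances `η_W, κ_a, κ_g, κ_T` of the budget
(helper M) with the moduli `λ` of `g` and `d` of `a`; the tail level `V` from the cubic tails at tolerance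
`δ'κ_T/(τ+1)`; `WindowCovarianceIsotropy` applied to `g₊` and `g₋` at `(η_W, δ')`; `r₀` the least of the resulting
radii, of the `O(r)` threshold of the budget, of `d ∧ 1` and `1/2`; `N₀` the largest of the resulting particle numbers.
Off a null set and six bad events of probability `≤ δ'` the pathwise bound of helper K (`pathwise_bound`) and the
budget of helper M (`window_budget`) give `|F| ≤ η`.

REFERENCES.  Helpers A–K, M of this stub (`JParityClosureParityBandClosureStressIsotropyOfWindowCovarianceA–M.lean`);
lead NOTES of the line (`Cruxes/ParityBandClosure/Lines/TransferWeightedParityChain.lean`, header (A)).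
-/

noncomputable section

namespace Summit.AtomisticToContinuum.HydrodynamicLimit.Theorems.ParityBandClosureWindowToCone

open scoped BigOperators Topology Classical MeasureTheory ENNReal InnerProductSpace
open Filter Set MeasureTheory
open Literature.MathematicalPhysics.KineticTheory Literature.Analysis.FluidPDE
open Summit.AtomisticToContinuum.HydrodynamicLimit.Theses
open Summit.AtomisticToContinuum.HydrodynamicLimit.Theorems.LocalSecondLawNegative
open Summit.AtomisticToContinuum.HydrodynamicLimit.Theorems.LocalSecondLawLedger
open Summit.AtomisticToContinuum.HydrodynamicLimit.Theorems.ChaosClosesEulerReduction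
open Summit.AtomisticToContinuum.HydrodynamicLimit.Theorems.ChaosClosesEulerStressIsotropy

/-! ## §1 The waypoint Props (VERBATIM the skeleton) -/

/-- Registered stub signature (waypoint, skeleton v4 of line `transfer-weighted-parity-chain`, crux
`ParityBandClosure`, stmt-AtomisticToContinuum-17608; route-internal, not a cited fact; body VERBATIM):
**Weak isotropy of the local pressure tensor, in band, pre-shock** (sister `WeakStressIsotropyInBand`, verbatim) — a
SCALE-`r` statement (`∀η ∃r₀ ∀r<r₀ ∃N₀`); in THIS line the output of the kinetic half, here of the window-to-cone step. -/
def WeakStressIsotropyInBand : Prop :=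
  ∃ η₀ : ℝ, 0 < η₀ ∧ ∀ (a₀ θ₀ : T3 → ℝ) (u₀ : T3 → V3), Continuous a₀ → Continuous θ₀ → Continuous u₀ →
    (∀ x, 0 < a₀ x) → (∀ x, 0 < θ₀ x) → ∃ σ₀ : ℝ, 0 < σ₀ ∧ ∀ σ : ℝ, 0 < σ → σ < σ₀ →
    ∀ (T : ℝ) (ρ θ : ℝ → T3 → ℝ) (u : ℝ → T3 → V3), IsHardSphereEulerSolution σ T ρ u θ →
    ∀ Φ : (N : ℕ) → HardSphereFlow (Torus.geometry (Fin 3)) (hsDiameter σ N) (N + 1),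
    TendstoHydroFieldsAt (fun N => localGibbsLaw σ a₀ u₀ θ₀ N (Φ N)) Φ ρ u θ 0 →
    ∀ t ∈ Set.Ico 0 T, ∀ a : Fin 3 → Fin 3 → ℝ × T3 → ℝ, (∀ j k, Continuous (a j k)) →
    (∀ p, ∑ j : Fin 3, a j j p = 0) →
    ∀ g : ℝ → ℝ, Continuous g → (∀ b, η₀ ≤ b → g b = 0) →
    ∀ η δ : ℝ, 0 < η → 0 < δ → ∃ r₀ : ℝ, 0 < r₀ ∧ ∀ r : ℝ, 0 < r → r < r₀ → ∃ N₀ : ℕ, ∀ N : ℕ, N₀ ≤ N →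
    let bx : T3 → T3 → ℝ := fun y x => 3 / (Real.pi * r ^ 3) * max (1 - Torus.euclidDist y x / r) 0
    let ρm : Config (N + 1) (Fin 3) T3 → T3 → ℝ := fun w x₀ => ∫ q, bx q.1 x₀ ∂(empiricalMeasure w)
    let mm : Config (N + 1) (Fin 3) T3 → T3 → V3 := fun w x₀ => ∫ q, bx q.1 x₀ • q.2 ∂(empiricalMeasure w)
    let Pm : Config (N + 1) (Fin 3) T3 → T3 → Fin 3 → Fin 3 → ℝ := fun w x₀ j k =>
      (∫ q, bx q.1 x₀ * (q.2 j * q.2 k) ∂(empiricalMeasure w)) - mm w x₀ j * mm w x₀ k / ρm w x₀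
    localGibbsLaw σ a₀ u₀ θ₀ N (Φ N)
      {z | η < |∫ s in Set.Icc 0 t, ∫ x, g (σ ^ 3 * ρm ((Φ N).flow s z) x) *
        ∑ j : Fin 3, ∑ k : Fin 3, a j k (s, x) * Pm ((Φ N).flow s z) x j k|} ≤ ENNReal.ofReal δ

/-- Registered stub signature (waypoint, skeleton v4 of line `transfer-weighted-parity-chain`, crux
`ParityBandClosure`, stmt-AtomisticToContinuum-17608; route-internal, not a cited fact; body VERBATIM):
**Isotropy of the window covariances, in band, pre-shock** (OWN waypoint of v4).  Frame VERBATIM the PW inputs'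
(Euler-tied local-Gibbs data, horizon `0 < τ < T`, nonneg continuous density cut-off `g` vanishing above `η₀`); windows
at `(t₀, x₀) ∈ [0,τ] × 𝕋³` = tent in time of width `r²` × cone in space of width `r` (the SAME `bt`, `bx` as
`OddContactSymmetryPW` / `RateFloorPW` v3); window mass `ρ_w = ∫bt ρ_r`, window momentum `m_w = ∫bt m_r`, window second
moments `E_w = ∫bt ∫b_x v⊗v dμ_s`, and `C_w := E_w − m_w⊗m_w/ρ_w` (= `ρ_w ×` the central covariance of the normalised window
law; Lean `x/0 = 0` on empty windows, where `E_w = 0` too).  CLAIM: the `g(σ³ρ_w)`-weighted `L¹(dt₀dx₀)`-norm of the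
DEVIATOR of `C_w` (entrywise `ℓ¹` distance to `(tr C_w/3)𝟙`) is small in probability, `N → ∞` then `r → 0`.  This is
exactly what `ParityStability` delivers window by window (good windows: deviator `≤ ρ_w(9ε + 9ε²)`; bad / dilute / hot /
high-moment windows: deviator `≤ 2 tr C_w ≤ 4∫bt e_r`, priced by their energy) and exactly what the window-to-cone
identity consumes (`a` traceless ⇒ `a:C_w = a:dev C_w`). -/
def WindowCovarianceIsotropy : Prop :=
  ∃ η₀ : ℝ, 0 < η₀ ∧ ∀ (a₀ θ₀ : T3 → ℝ) (u₀ : T3 → V3), Continuous a₀ → Continuous θ₀ → Continuous u₀ →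
    (∀ x, 0 < a₀ x) → (∀ x, 0 < θ₀ x) → ∃ σ₀ : ℝ, 0 < σ₀ ∧ ∀ σ : ℝ, 0 < σ → σ < σ₀ →
    ∀ (T : ℝ) (ρ θ : ℝ → T3 → ℝ) (u : ℝ → T3 → V3), IsHardSphereEulerSolution σ T ρ u θ →
    ∀ Φ : (N : ℕ) → HardSphereFlow (Torus.geometry (Fin 3)) (hsDiameter σ N) (N + 1),
    TendstoHydroFieldsAt (fun N => localGibbsLaw σ a₀ u₀ θ₀ N (Φ N)) Φ ρ u θ 0 →
    ∀ τ : ℝ, 0 < τ → τ < T → ∀ g : ℝ → ℝ, Continuous g → (∀ b, η₀ ≤ b → g b = 0) → (∀ b, 0 ≤ g b) →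
    ∀ η δ : ℝ, 0 < η → 0 < δ → ∃ r₀ : ℝ, 0 < r₀ ∧ ∀ r : ℝ, 0 < r → r < r₀ → ∃ N₀ : ℕ, ∀ N : ℕ, N₀ ≤ N →
    let γ : Config (N + 1) (Fin 3) T3 → ℝ → Config (N + 1) (Fin 3) T3 := fun z s => (Φ N).flow s z
    let bx : T3 → T3 → ℝ := fun y x₀ => 3 / (Real.pi * r ^ 3) * max (1 - Torus.euclidDist y x₀ / r) 0
    let bt : ℝ → ℝ := fun a => (r ^ 2)⁻¹ * max (1 - |a| / r ^ 2) 0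
    let ρw : Config (N + 1) (Fin 3) T3 → ℝ → T3 → ℝ := fun z t₀ x₀ =>
      ∫ s in Set.Icc (0 : ℝ) τ, bt (s - t₀) * ∫ q, bx q.1 x₀ ∂(empiricalMeasure (γ z s))
    let mw : Config (N + 1) (Fin 3) T3 → ℝ → T3 → Fin 3 → ℝ := fun z t₀ x₀ j =>
      ∫ s in Set.Icc (0 : ℝ) τ, bt (s - t₀) * ∫ q, bx q.1 x₀ * q.2 j ∂(empiricalMeasure (γ z s))
    let Ew : Config (N + 1) (Fin 3) T3 → ℝ → T3 → Fin 3 → Fin 3 → ℝ := fun z t₀ x₀ j k =>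
      ∫ s in Set.Icc (0 : ℝ) τ, bt (s - t₀) * ∫ q, bx q.1 x₀ * (q.2 j * q.2 k) ∂(empiricalMeasure (γ z s))
    let Cw : Config (N + 1) (Fin 3) T3 → ℝ → T3 → Fin 3 → Fin 3 → ℝ := fun z t₀ x₀ j k =>
      Ew z t₀ x₀ j k - mw z t₀ x₀ j * mw z t₀ x₀ k / ρw z t₀ x₀
    let dev : Config (N + 1) (Fin 3) T3 → ℝ → T3 → ℝ := fun z t₀ x₀ =>
      ∑ j : Fin 3, ∑ k : Fin 3, |Cw z t₀ x₀ j k - if j = k then (∑ l : Fin 3, Cw z t₀ x₀ l l) / 3 else 0|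
    let D : Config (N + 1) (Fin 3) T3 → ℝ := fun z =>
      ∫ t₀ in Set.Icc (0 : ℝ) τ, ∫ x₀ : T3, g (σ ^ 3 * ρw z t₀ x₀) * dev z t₀ x₀
    localGibbsLaw σ a₀ u₀ θ₀ N (Φ N) {z | η < D z} ≤ ENNReal.ofReal δ


/-! ## §2 The assembly in probability at fixed `(σ, T, ρ, θ, u, Φ, t)` -/

/-- **THE WINDOW-TO-CONE STEP IN PROBABILITY** at fixed `(σ, t)`: from `WindowCovarianceIsotropy`, `DensityCap`, the
cubic tails and collision tightness, all specialised to the data, weak stress isotropy in band (see the module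
docstring for the order of the choices). [folklore] -/
theorem weakStressIsotropy_of_windowCovariance {σ : ℝ} (hσ : 0 < σ) (hσ4 : σ < 1 / 4) {a₀ θ₀ : T3 → ℝ} {u₀ : T3 → V3}
    (ha : Continuous a₀) (hθc : Continuous θ₀) (hu : Continuous u₀) (ha0 : ∀ x, 0 < a₀ x) (hθ0 : ∀ x, 0 < θ₀ x)
    {T : ℝ} {ρ θ : ℝ → T3 → ℝ} {u : ℝ → T3 → V3} (hsol : IsHardSphereEulerSolution σ T ρ u θ)
    (Φ : (N : ℕ) → HardSphereFlow (Torus.geometry (Fin 3)) (hsDiameter σ N) (N + 1)) {t : ℝ} (ht : t ∈ Set.Ico 0 T)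
    {η₀ : ℝ}
    (hW : ∀ τ : ℝ, 0 < τ → τ < T → ∀ g : ℝ → ℝ, Continuous g → (∀ b, η₀ ≤ b → g b = 0) → (∀ b, 0 ≤ g b) →
      ∀ η δ : ℝ, 0 < η → 0 < δ → ∃ r₀ : ℝ, 0 < r₀ ∧ ∀ r : ℝ, 0 < r → r < r₀ → ∃ N₀ : ℕ, ∀ N : ℕ, N₀ ≤ N →
      localGibbsLaw σ a₀ u₀ θ₀ N (Φ N) {z | η < ∫ t₀ in Icc 0 τ, ∫ x, g (σ ^ 3 * ∫ s in Icc 0 τ, (r ^ 2)⁻¹ * max (1 - |s - t₀| / r ^ 2) 0 * rhoC r ((Φ N).flow s z) x) * ∑ j : Fin 3, ∑ k : Fin 3, |((∫ s in Icc 0 τ, (r ^ 2)⁻¹ * max (1 - |s - t₀| / r ^ 2) 0 * MpsiC r ((Φ N).flow s z) x (fun v => v j * v k)) - (∫ s in Icc 0 τ, (r ^ 2)⁻¹ * max (1 - |s - t₀| / r ^ 2) 0 * MpsiC r ((Φ N).flow s z) x (fun v => v j)) * (∫ s in Icc 0 τ, (r ^ 2)⁻¹ * max (1 - |s - t₀|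 / r ^ 2) 0 * MpsiC r ((Φ N).flow s z) x (fun v => v k)) / (∫ s in Icc 0 τ, (r ^ 2)⁻¹ * max (1 - |s - t₀| / r ^ 2) 0 * rhoC r ((Φ N).flow s z) x)) - if j = k then (∑ l, ((∫ s in Icc 0 τ, (r ^ 2)⁻¹ * max (1 - |s - t₀| / r ^ 2) 0 * MpsiC r ((Φ N).flow s z) x (fun v => v l * v l)) - (∫ s in Icc 0 τ, (r ^ 2)⁻¹ * max (1 - |s - t₀| / r ^ 2) 0 * MpsiC r ((Φ N).flow s z) x (fun v => v l)) * (∫ s in Icc 0 τ, (r ^ 2)⁻¹ * max (1 - |s - t₀| / r ^ 2) 0 * MpsiC r ((Φ N).flow s z) x (fun v => v l)) / (∫ s in Icc 0 τ, (r ^ 2)⁻¹ * max (1 - |s - t₀| / r ^ 2) 0 * rhoC r ((Φ N).flow s z) x))) / 3 else 0|} ≤ ENNReal.ofReal δ)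
    (hD : ∀ t' ∈ Set.Ico 0 T, ∀ η δ : ℝ, 0 < η → 0 < δ → ∃ r₀ : ℝ, 0 < r₀ ∧ ∀ r : ℝ, 0 < r → r < r₀ →
      ∃ N₀ : ℕ, ∀ N : ℕ, N₀ ≤ N →
      localGibbsLaw σ a₀ u₀ θ₀ N (Φ N) {z | ∃ s ∈ Set.Icc 0 t', ∃ x : T3, ρ s x + η < rhoC r ((Φ N).flow s z) x} ≤
        ENNReal.ofReal δ)
    (hE : ∀ t' ∈ Set.Ico 0 T, ∀ ε : ℝ, 0 < ε → ∃ M : ℝ, ∃ N₀ : ℕ, ∀ N : ℕ, N₀ ≤ N → ∀ s ∈ Set.Icc 0 t',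
      ∫⁻ z, ENNReal.ofReal (((N : ℝ) + 1)⁻¹ * ∑ i : Fin (N + 1),
        Set.indicator {v : V3 | M < ‖v‖} (fun v => ‖v‖ ^ 3) (((Φ N).flow s z i).2)) ∂(localGibbsLaw σ a₀ u₀ θ₀ N (Φ N)) ≤
        ENNReal.ofReal ε)
    (hC : ∀ τ : ℝ, 0 < τ → ∀ δ : ℝ, 0 < δ → ∃ Kb : ℝ, ∃ N₀ : ℕ, ∀ N : ℕ, N₀ ≤ N →
      localGibbsLaw σ a₀ u₀ θ₀ N (Φ N) {z | Kb < hsDiameter σ N / (N + 1 : ℝ) * ∫ m, (1 + ‖m.2.2.2.1‖ ^ 4 + ‖m.2.2.2.2‖ ^ 4) * (1 + 1 / (Real.pi * ‖m.2.2.2.1 - m.2.2.2.2‖)) ∂((Φ N).empiricalCollisionMeasure (Set.Icc 0 τ) z)} ≤ ENNReal.ofReal δ)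
    (a : Fin 3 → Fin 3 → ℝ × T3 → ℝ) (hac : ∀ j k, Continuous (a j k)) (htr : ∀ p, ∑ j, a j j p = 0)
    (g : ℝ → ℝ) (hgc : Continuous g) (hg0 : ∀ b, η₀ ≤ b → g b = 0) {η δ : ℝ} (hη : 0 < η) (hδ : 0 < δ) :
    ∃ r₀ : ℝ, 0 < r₀ ∧ ∀ r : ℝ, 0 < r → r < r₀ → ∃ N₀ : ℕ, ∀ N : ℕ, N₀ ≤ N →
      localGibbsLaw σ a₀ u₀ θ₀ N (Φ N) {z | η < |∫ s in Set.Icc 0 t, ∫ x : T3, g (σ ^ 3 * rhoC r ((Φ N).flow s z) x) * ∑ j, ∑ k, a j k (s, x) * (MpsiC r ((Φ N).flow s z) x (fun v => v j * v k) - momC r ((Φ N).flow s z) x j * momC r ((Φ N).flow s z) x k / rhoC r ((Φ N).flow s z) x)|} ≤ ENNReal.ofReal δ := by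
  have hσ2 : σ < 1 / 2 := hσ4.trans (by norm_num)
  have hσhalf : σ ≤ 1 / 2 := hσ2.le
  -- ### the horizon
  set τ : ℝ := (t + T) / 2 with hτdef
  have hT0 : 0 < T := ht.1.trans_lt ht.2
  have hτ0 : 0 < τ := by rw [hτdef]; linarith [ht.1]
  have htτ : t ≤ τ := by rw [hτdef]; linarith [ht.2]
  have hτT : τ < T := by rw [hτdef]; linarith [ht.2]
  have hτmem : τ ∈ Set.Ico 0 T := ⟨hτ0.le, hτT⟩
  -- ### the data bounds
  obtain ⟨Gb, hGb0, hGb⟩ := exists_bound_of_vanishing hgc hg0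
  obtain ⟨A, hA0, hA⟩ := exists_bound_matrix a hac τ
  -- ### the tolerances, in order
  have hδ' : 0 < δ / 7 := by positivity
  obtain ⟨KE, hKE0, hKev⟩ := KineticClosureBridge.exists_energy_tail_le (u₀ := u₀) ha hθc hu ha0 hθ0 hσhalf hδ'
  obtain ⟨Cρ, hCρ0, hCρ⟩ := ChaosClosesEulerReadout.exists_bound_of_continuousOn_uncurry
    (ChaosClosesEulerReadout.euler_continuousOn hsol le_rfl hτT).1
  set Rcap : ℝ := Cρ + 1 with hRcap
  have hRcap0 : 0 ≤ Rcap := by rw [hRcap]; linarith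
  obtain ⟨rD, hrD, HD2⟩ := hD τ hτmem 1 (δ / 7) one_pos hδ'
  obtain ⟨Kb₀, NC, HC2⟩ := hC τ hτ0 (δ / 7) hδ'
  set Kb : ℝ := max Kb₀ 0 with hKb
  have hKb0 : 0 ≤ Kb := le_max_right _ _
  set ηW : ℝ := η / (16 * (A + 1)) with hηW
  set κa : ℝ := η / (8 * (30 * Gb * KE * τ + 1)) with hκa
  set κg : ℝ := η / (8 * (30 * A * KE * τ + 1)) with hκg
  have hηW0 : 0 < ηW := by positivity
  have hκa0 : 0 < κa := by positivity
  have hκg0 : 0 < κg := by positivity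
  obtain ⟨lam, hlam, hmodg⟩ := exists_modulus_of_vanishing hgc hg0 hκg0
  -- the time modulus of `a` on `[0, τ] × 𝕋³`
  have hmoda : ∀ jk : Fin 3 × Fin 3, ∃ d : ℝ, 0 < d ∧ ∀ s ∈ Icc 0 τ, ∀ t₀ ∈ Icc 0 τ, ∀ x x₀ : T3,
      |s - t₀| < d → Torus.euclidDist x x₀ < d → |a jk.1 jk.2 (t₀, x₀) - a jk.1 jk.2 (s, x)| ≤ κa := fun jk =>
    ChaosClosesEulerPressureValue.exists_modulus_spaceTime (hac jk.1 jk.2) 0 τ hκa0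
  choose d hd hmodd using hmoda
  set da : ℝ := Finset.univ.inf' Finset.univ_nonempty d with hda
  have hda0 : 0 < da := (Finset.lt_inf'_iff _).2 fun jk _ => hd jk
  have hda_le : ∀ jk, da ≤ d jk := fun jk => Finset.inf'_le _ (Finset.mem_univ jk)
  set cT : ℝ := Gb * (3 * A) * 10 + Gb * A * σ ^ 3 * Rcap / lam * 30 with hcT
  set κT : ℝ := η / (8 * (cT + 1)) with hκT
  have hcT0 : 0 ≤ cT := by positivity
  have hκT0 : 0 < κT := by positivity
  have hεT : 0 < δ / 7 * κT / (τ + 1) := by positivity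
  obtain ⟨M₀, NT, HE2⟩ := hE τ hτmem (δ / 7 * κT / (τ + 1)) hεT
  set V : ℝ := max M₀ 1 with hVdef
  have hV1 : 1 ≤ V := le_max_right _ _
  have hVM : M₀ ≤ V := le_max_left _ _
  have hV0 : 0 < V := one_pos.trans_le hV1
  set Lr : ℝ := 4 * (30 * Gb * A * KE) + Gb * (3 * A) * (4 * V * (16 * KE * τ + 16 * Kb) +
      4 * V ^ 2 * (8 * (1 / 2 + KE) * τ)) + Gb * A * σ ^ 3 * Rcap / lam * (60 * V ^ 2 * (8 * (1 / 2 + KE) * τ)) with hLr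
  have hLr0 : 0 ≤ Lr := by positivity
  set r₁ : ℝ := η / (4 * (Lr + 1)) with hr₁
  have hr₁0 : 0 < r₁ := by positivity
  -- `WindowCovarianceIsotropy` for the two signed parts of `g`
  obtain ⟨hgpc, hgp0, hgpn⟩ := posPart_props hgc hg0
  obtain ⟨hgmc, hgm0, hgmn⟩ := negPart_props hgc hg0
  obtain ⟨rWp, hrWp, HWp⟩ := hW τ hτ0 hτT (fun b => max (g b) 0) hgpc hgp0 hgpn ηW (δ / 7) hηW0 hδ'
  obtain ⟨rWm, hrWm, HWm⟩ := hW τ hτ0 hτT (fun b => max (-g b) 0) hgmc hgm0 hgmn ηW (δ / 7) hηW0 hδ'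
  -- ### the mollification threshold
  refine ⟨min (min rD (min rWp rWm)) (min r₁ (min (min da 1) (1 / 2))), by positivity, fun r hr hrr₀ => ?_⟩
  have hrD' : r < rD := hrr₀.trans_le ((min_le_left _ _).trans (min_le_left _ _))
  have hrWp' : r < rWp := hrr₀.trans_le ((min_le_left _ _).trans ((min_le_right _ _).trans (min_le_left _ _)))
  have hrWm' : r < rWm := hrr₀.trans_le ((min_le_left _ _).trans ((min_le_right _ _).trans (min_le_right _ _)))
  have hr₁' : r ≤ r₁ := (hrr₀.trans_le ((min_le_right _ _).trans (min_le_left _ _))).le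
  have hrda : r < da := hrr₀.trans_le ((min_le_right _ _).trans ((min_le_right _ _).trans ((min_le_left _ _).trans (min_le_left _ _))))
  have hr1 : r < 1 := hrr₀.trans_le ((min_le_right _ _).trans ((min_le_right _ _).trans ((min_le_left _ _).trans (min_le_right _ _))))
  have hr2 : r < 1 / 2 := hrr₀.trans_le ((min_le_right _ _).trans ((min_le_right _ _).trans (min_le_right _ _)))
  have hrr : r ^ 2 < r := by rw [sq]; exact mul_lt_of_lt_one_right hr hr1
  have hrsq : r ^ 2 < da := hrr.trans hrda
  obtain ⟨NDr, HD3⟩ := HD2 r hr hrD'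
  obtain ⟨NWp, HWp3⟩ := HWp r hr hrWp'
  obtain ⟨NWm, HWm3⟩ := HWm r hr hrWm'
  -- ### the particle-number threshold
  refine ⟨max (max NDr (max NWp NWm)) (max NT NC), fun N hN => ?_⟩
  have hNDr : NDr ≤ N := le_trans ((le_max_left _ _).trans (le_max_left _ _)) hN
  have hNWp : NWp ≤ N := le_trans (((le_max_left _ _).trans (le_max_right _ _)).trans (le_max_left _ _)) hN
  have hNWm : NWm ≤ N := le_trans (((le_max_right _ _).trans (le_max_right _ _)).trans (le_max_left _ _)) hN
  have hNT : NT ≤ N := le_trans ((le_max_left _ _).trans (le_max_right _ _)) hN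
  have hNC : NC ≤ N := le_trans ((le_max_right _ _).trans (le_max_right _ _)) hN
  set P := localGibbsLaw σ a₀ u₀ θ₀ N (Φ N) with hP
  haveI : IsProbabilityMeasure P := isProbabilityMeasure_localGibbsLaw ha hθc hu ha0 hθ0 hσhalf N (Φ N)
  have hPgood : P (Φ N).goodᶜ = 0 := localGibbsLaw_compl_good_eq_zero (Φ N)
  -- ### the six bad events
  have hS₁ : P {z | KE < ((N : ℝ) + 1)⁻¹ * configEnergy ((Φ N).flow 0 z)} ≤ ENNReal.ofReal (δ / 7) := hKev N (Φ N) 0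
  have hS₂ : P {z | ∃ s ∈ Set.Icc 0 τ, ∃ x : T3, ρ s x + 1 < rhoC r ((Φ N).flow s z) x} ≤ ENNReal.ofReal (δ / 7) :=
    HD3 N hNDr
  have hS₃ : P {z | κT < ∫ s in Icc 0 τ, ((N + 1 : ℕ) : ℝ)⁻¹ * ∑ i, sqTail V (((Φ N).flow s z) i).2} ≤
      ENNReal.ofReal (δ / 7) := by
    have h1 := measure_tailEvent_le (Φ N) (P := P) hPgood hV1 hVM hτ0.le hεT.le
      (fun s hs => HE2 N hNT s ⟨hs.1.le, hs.2⟩) hκT0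
    refine h1.trans (ENNReal.ofReal_le_ofReal ?_)
    have e : τ * (δ / 7 * κT / (τ + 1)) / κT = τ * (δ / 7 / (τ + 1)) := by field_simp
    rw [e]
    exact mul_div_add_one_le hτ0.le hδ'.le
  have hS₄ : P {z | Kb₀ < hsDiameter σ N / (N + 1 : ℝ) * ∫ m, (1 + ‖m.2.2.2.1‖ ^ 4 + ‖m.2.2.2.2‖ ^ 4) * (1 + 1 / (Real.pi * ‖m.2.2.2.1 - m.2.2.2.2‖)) ∂((Φ N).empiricalCollisionMeasure (Set.Icc 0 τ) z)} ≤ ENNReal.ofReal (δ / 7) := HC2 N hNC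
  have hS₅ : P {z | ηW < ∫ t₀ in Icc 0 τ, ∫ x, max (g (σ ^ 3 * ∫ s in Icc 0 τ, (r ^ 2)⁻¹ * max (1 - |s - t₀| / r ^ 2) 0 * rhoC r ((Φ N).flow s z) x)) 0 * ∑ j : Fin 3, ∑ k : Fin 3, |((∫ s in Icc 0 τ, (r ^ 2)⁻¹ * max (1 - |s - t₀| / r ^ 2) 0 * MpsiC r ((Φ N).flow s z) x (fun v => v j * v k)) - (∫ s in Icc 0 τ, (r ^ 2)⁻¹ * max (1 - |s - t₀| / r ^ 2) 0 * MpsiC r ((Φ N).flow s z) x (fun v => v j)) * (∫ s in Icc 0 τ, (r ^ 2)⁻¹ * max (1 - |s - t₀| / r ^ 2) 0 * MpsiC r ((Φ N).flow s z) x (fun v => v k)) / (∫ s in Icc 0 τ, (r ^ 2)⁻¹ * max (1 - |s - t₀| / r ^ 2) 0 * rhoC r ((Φ N).flow s z) x)) - if j = k then (∑ l, ((∫ s in Icc 0 τ, (r ^ 2)⁻¹ * max (1 - |s - t₀| / r ^ 2) 0 * MpsiC r ((Φ N).flow s z) x (fun v => v l * v l)) - (∫ s in Icc 0 τ, (r ^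 2)⁻¹ * max (1 - |s - t₀| / r ^ 2) 0 * MpsiC r ((Φ N).flow s z) x (fun v => v l)) * (∫ s in Icc 0 τ, (r ^ 2)⁻¹ * max (1 - |s - t₀| / r ^ 2) 0 * MpsiC r ((Φ N).flow s z) x (fun v => v l)) / (∫ s in Icc 0 τ, (r ^ 2)⁻¹ * max (1 - |s - t₀| / r ^ 2) 0 * rhoC r ((Φ N).flow s z) x))) / 3 else 0|} ≤ ENNReal.ofReal (δ / 7) := HWp3 N hNWp
  have hS₆ : P {z | ηW < ∫ t₀ in Icc 0 τ, ∫ x, max (-g (σ ^ 3 * ∫ s in Icc 0 τ, (r ^ 2)⁻¹ * max (1 - |s - t₀| / r ^ 2) 0 * rhoC r ((Φ N).flow s z) x)) 0 * ∑ j : Fin 3, ∑ k : Fin 3, |((∫ s in Icc 0 τ, (r ^ 2)⁻¹ * max (1 - |s - t₀| / r ^ 2) 0 * MpsiC r ((Φ N).flow s z) x (fun v => v j * v k)) - (∫ s in Icc 0 τ, (r ^ 2)⁻¹ * max (1 - |s - t₀| / r ^ 2) 0 * MpsiC r ((Φ N).flow s z) x (fun v => v j)) * (∫ s in Icc 0 τ,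 (r ^ 2)⁻¹ * max (1 - |s - t₀| / r ^ 2) 0 * MpsiC r ((Φ N).flow s z) x (fun v => v k)) / (∫ s in Icc 0 τ, (r ^ 2)⁻¹ * max (1 - |s - t₀| / r ^ 2) 0 * rhoC r ((Φ N).flow s z) x)) - if j = k then (∑ l, ((∫ s in Icc 0 τ, (r ^ 2)⁻¹ * max (1 - |s - t₀| / r ^ 2) 0 * MpsiC r ((Φ N).flow s z) x (fun v => v l * v l)) - (∫ s in Icc 0 τ, (r ^ 2)⁻¹ * max (1 - |s - t₀| / r ^ 2) 0 * MpsiC r ((Φ N).flow s z) x (fun v => v l)) * (∫ s in Icc 0 τ, (r ^ 2)⁻¹ * max (1 - |s - t₀| / r ^ 2) 0 * MpsiC r ((Φ N).flow s z) x (fun v => v l)) / (∫ s in Icc 0 τ, (r ^ 2)⁻¹ * max (1 - |s - t₀| / r ^ 2) 0 * rhoC r ((Φ N).flow s z) x))) / 3 else 0|} ≤ ENNReal.ofReal (δ / 7) := HWm3 N hNWm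
  -- ### off the bad events: the pathwise bound and the budget
  have hcov := measure_le_of_cover6 P (D := {z | η < |∫ s in Set.Icc 0 t, ∫ x : T3, g (σ ^ 3 * rhoC r ((Φ N).flow s z) x) * ∑ j, ∑ k, a j k (s, x) * (MpsiC r ((Φ N).flow s z) x (fun v => v j * v k) - momC r ((Φ N).flow s z) x j * momC r ((Φ N).flow s z) x k / rhoC r ((Φ N).flow s z) x)|})
    hPgood hS₁ hS₂ hS₃ hS₄ hS₅ hS₆ (fun z hz h1 h2 h3 h4 h5 h6 => by
      have hzg : z ∈ (Φ N).good := Set.notMem_compl_iff.1 hz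
      simp only [Set.mem_setOf_eq, not_lt, not_exists, not_and] at h1 h2 h3 h4 h5 h6 ⊢
      -- energy
      have hKEz : ke z ≤ KE := by
        rw [ke_eq_configEnergy, Nat.cast_succ, ← (Φ N).flow_zero z hzg]; exact h1
      -- density cap
      have hcap : ∀ s ∈ Icc 0 τ, ∀ x : T3, rhoC r ((Φ N).flow s z) x ≤ Rcap := by
        intro s hs x
        have h2' := h2 s hs x
        have hρ : ρ s x ≤ Cρ := (le_abs_self _).trans (by rw [← Real.norm_eq_abs]; exact hCρ s hs x)
        rw [hRcap]; linarith
      -- collision level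
      have hKbz : hsDiameter σ N / (N + 1 : ℝ) * ∫ m, (1 + ‖m.2.2.2.1‖ ^ 4 + ‖m.2.2.2.2‖ ^ 4) * (1 + 1 / (Real.pi * ‖m.2.2.2.1 - m.2.2.2.2‖)) ∂((Φ N).empiricalCollisionMeasure (Set.Icc 0 τ) z) ≤ Kb := h4.trans (le_max_left _ _)
      -- the modulus of `a`
      have hκa' : ∀ j k, ∀ s ∈ Icc 0 τ, ∀ t₀ ∈ Icc 0 τ, ∀ x : T3, |s - t₀| ≤ r ^ 2 →
          |a j k (s, x) - a j k (t₀, x)| ≤ κa := by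
        intro j k s hs t₀ ht₀ x hst
        have h7 := hmodd (j, k) s hs t₀ ht₀ x x (hst.trans_lt (hrsq.trans_le (hda_le (j, k))))
          (by rw [Torus.euclidDist_self]; exact (hd (j, k)))
        rwa [abs_sub_comm] at h7
      have hpw := pathwise_bound hσ hσ2 (Φ N) hzg hr hr2 ht.1 htτ hV0 a hac htr hA hκa0.le hκa' g hgc hGb hlam hκg0.le hmodg
        hcap hKEz h3 hKbz h5 h6
      exact hpw.trans (window_budget hη hA0 hGb0 hKE0 hτ0.le hσ.le hRcap0 hlam hV0.le hKb0 hr.le hr1.le rfl rfl rfl rfl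
        hr₁'))
    (by positivity)
  exact hcov.trans (ENNReal.ofReal_le_ofReal (by linarith only [hδ]))

/-! ## §3 The registered stub -/

/-- **Registered stub `stub_stressIsotropyOfWindowCovariance` (line `transfer-weighted-parity-chain`, skeleton v4, crux
stmt-AtomisticToContinuum-17608): the WINDOW-TO-CONE step** — `WindowCovarianceIsotropy` + `DensityCap` + the cubic
tails (9235) + collision tightness (13354) ⇒ `WeakStressIsotropyInBand` (bodies VERBATIM the skeleton). [folklore] -/
theorem stub_stressIsotropyOfWindowCovariance :
    WindowCovarianceIsotropy → JParityClosure.DensityCap → TwoClocks.EnergyCurrentTails →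
    LimitCollisionMeasure.CollisionTightness → WeakStressIsotropyInBand := by
  intro hWCI hDC hECT hCT
  obtain ⟨η₀, hη₀, HW⟩ := hWCI
  refine ⟨η₀, hη₀, fun a₀ θ₀ u₀ ha hθ hu ha0 hθ0 => ?_⟩
  obtain ⟨σW, hσW, HW1⟩ := HW a₀ θ₀ u₀ ha hθ hu ha0 hθ0
  obtain ⟨σD, hσD, HD1⟩ := hDC a₀ θ₀ u₀ ha hθ hu ha0 hθ0
  obtain ⟨σE, hσE, HE1⟩ := hECT a₀ θ₀ u₀ ha hθ hu ha0 hθ0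
  obtain ⟨σC, hσC, HC1⟩ := hCT a₀ θ₀ u₀ ha hθ hu ha0 hθ0
  refine ⟨min σW (min σD (min σE (min σC (1 / 4)))), lt_min hσW (lt_min hσD (lt_min hσE (lt_min hσC (by norm_num)))),
    fun σ hσ hσlt T ρ θ u hsol Φ htie t ht a hac htr g hgc hg0 η δ hη hδ => ?_⟩
  have hσW' : σ < σW := hσlt.trans_le (min_le_left _ _)
  have hσD' : σ < σD := hσlt.trans_le ((min_le_right _ _).trans (min_le_left _ _))
  have hσE' : σ < σE := hσlt.trans_le ((min_le_right _ _).trans ((min_le_right _ _).trans (min_le_left _ _)))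
  have hσC' : σ < σC := hσlt.trans_le ((min_le_right _ _).trans ((min_le_right _ _).trans ((min_le_right _ _).trans
    (min_le_left _ _))))
  have hσ4 : σ < 1 / 4 := hσlt.trans_le ((min_le_right _ _).trans ((min_le_right _ _).trans ((min_le_right _ _).trans
    (min_le_right _ _))))
  exact weakStressIsotropy_of_windowCovariance hσ hσ4 ha hθ hu ha0 hθ0 hsol Φ ht
    (HW1 σ hσ hσW' T ρ θ u hsol Φ htie) (HD1 σ hσ hσD' T ρ θ u hsol Φ htie) (HE1 σ hσ hσE' T ρ θ u hsol Φ htie)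
    (HC1 σ hσ hσC' Φ) a hac htr g hgc hg0 hη hδ

end Summit.AtomisticToContinuum.HydrodynamicLimit.Theorems.ParityBandClosureWindowToCone

end
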